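import Summits.BirchSwinnertonDyer.BirchSwinnertonDyer.Theorems.KolyvaginRoadThreeMethod2Defs
import Literature.NumberTheory.EllipticCurves.HeegnerPointsKolyvaginLocalCriterion
import Literature.NumberTheory.EllipticCurves.HeegnerPointsKolyvaginConjugation
import Literature.NumberTheory.EllipticCurves.ZpExtensionProofs
import Literature.NumberTheory.EllipticCurves.KummerSelmerStructure
import Literature.NumberTheory.GaloisRepresentations.AbsIntegersEquiv
import Literature.NumberTheory.GaloisRepresentations.FrobeniusPlaces
import Literature.NumberTheory.GaloisRepresentations.IntegralGaloisActionProofs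
import HarnessLib

/-!
# Route `KolyvaginRoadThree`, deciding crux `ZhangSharpFrameAtThreeHL` (item stmt-BirchSwinnertonDyer-19574):
# the local input (H0) `h⁰(K_w, E[3]) ≤ 1` at a GOOD unipotent-admissible prime, PROVED
# (cell `bsd-stepL`, seat `bsd-stepL-koly` g13, OWNER of the METHOD line; `--supports stmt-BirchSwinnertonDyer-19574`, helper)

WHY THIS FILE. The siblings `…Method2IsoLocalDuality.lean` ∕ `…Method2IsoOrdinary.lean` ∕ `…Method2Iso.lean` (koly g13)
turn the inputs (Iso) (Poitou–Tate see-saw) and (Line) (the Kummer line) of the registered stub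
`stub_levelRaisingAtThree` (v2x; koly3a's five-input reduction p467211) into kernel theorems MODULO one local
hypothesis (H0): `Nat.card (E[3](K̄)|_{Γ_{K_w}})^{Γ_{K_w}} ≤ 3` at the place `w` of every GOOD unipotent-admissible
prime `q` (`Method2.FrobSqNeOneAt W 3 q`, the repair (R3) of koly g12's STUB-MISSTATED-3: the residual Frobenius at
`q` is non-scalar). This file PROVES (H0) — `natCard_invariants_le_three_of_frobSqNeOneAt` — from the skeleton's own
predicate, so that (Iso) and (Line) become UNCONDITIONAL: `Frob_q² ≠ 1` on `E[3](ℚ̄)` is transported to an element of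
the LOCAL Galois group `Γ_{K_w}` acting non-trivially on `E[3](K̄)`, through the tree's Gross-1991 machinery
(`HeegnerPointsKolyvaginLocalCriterion`: the local–global principle for decomposition groups `G_𝔓 = res(Γ_{K_v})`,
Neukirch II (9.6); `HeegnerPointsKolyvaginConjugation`: `E[3](ℚ̄) ≃ E[3](K̄)` equivariantly; `ZpExtensionProofs`:
transport `Γ_ℚ ≃ Aut_ℚ(K̄)`; `AbsIntegersEquiv` ∕ `FrobeniusPlaces`: primes of `\bar ℤ_K` versus their traces on
`\bar ℤ`). A proper subgroup of `E[3] ≅ (ℤ/3)²` has order `≤ 3`.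

HONEST FRAMING: one theorem (+ a private copy of a 10-line lemma on places of `ℚ`); no definition, no named fact,
no `sorry`; nothing about Heegner points or level raising; closes nothing (T7). PARTITION: O2@3 (B10) × A1 × crux
19574 — types-the-object-of (discharge of a local input of a registered stub); closes: none.

References: [cite: NeukirchANT1999, Ch. I §9, Ch. II (9.6)] [cite: WZhang2014, Notations (xii), Prop. 5.4]
[cite: BertoliniDarmon2005, §2.2 (admissible primes)] [cite: GrossLMS1991, §3 (3.2), §9 Prop. 9.6].
-/

noncomputable section

open scoped Classical Pointwise

namespace Summit.BirchSwinnertonDyer.Rank1Residual.X11b.Three.Koly.Method2.Iso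

open CategoryTheory WeierstrassCurve Field Function NumberField IsDedekindDomain
open Literature.NumberTheory.EllipticCurves Literature.NumberTheory.GaloisRepresentations
open Summit.BirchSwinnertonDyer.Rank1Residual.X11b.Three.Koly.Method2

/-- Places of `ℚ` containing the same rational prime coincide (a private copy of the tree's
`HeightOneSpectrum.eq_of_natCast_mem_rat`, file `HeegnerPointsKolyvaginCebotarevProofs`, whose imports are not wanted here:
`(ℓ) ⊂ 𝓞 ℚ ≅ ℤ` is maximal). [folklore] -/
private theorem eq_of_natCast_mem_rat' {ℓ : ℕ} (hℓ : ℓ.Prime) {v v' : HeightOneSpectrum (𝓞 ℚ)}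
    (hv : (ℓ : 𝓞 ℚ) ∈ v.asIdeal) (hv' : (ℓ : 𝓞 ℚ) ∈ v'.asIdeal) : v = v' := by
  have hprime : Prime (ℓ : 𝓞 ℚ) := by
    rw [← MulEquiv.prime_iff (Rat.ringOfIntegersEquiv : 𝓞 ℚ ≃+* ℤ).toMulEquiv]
    change Prime (Rat.ringOfIntegersEquiv (ℓ : 𝓞 ℚ))
    rw [map_natCast, ← Nat.prime_iff_prime_int]
    exact hℓ
  have hP : (Ideal.span {(ℓ : 𝓞 ℚ)}).IsPrime := (Ideal.span_singleton_prime hprime.ne_zero).mpr hprime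
  have hmax : (Ideal.span {(ℓ : 𝓞 ℚ)}).IsMaximal :=
    hP.isMaximal (by rw [Ne, Ideal.span_singleton_eq_bot]; exact hprime.ne_zero)
  have h1 := hmax.eq_of_le v.isPrime.ne_top ((Ideal.span_singleton_le_iff_mem _).mpr hv)
  have h2 := hmax.eq_of_le v'.isPrime.ne_top ((Ideal.span_singleton_le_iff_mem _).mpr hv')
  exact HeightOneSpectrum.ext (h1.symm.trans h2)

variable (W : WeierstrassCurve ℚ) (K : Type) [Field K] [NumberField K] [W.IsElliptic] [W.IsGloballyMinimal]

/-- **(H0): `h⁰(K_w, E[3]) ≤ 1` at a GOOD unipotent-admissible prime.** For `K` imaginary quadratic, `E = W/ℚ`, a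
unipotent-admissible prime `q` (only `q` prime is used) whose residual Frobenius is NON-SCALAR in the sense of the
registered skeleton (`Method2.FrobSqNeOneAt W 3 q`: some arithmetic Frobenius `h ∈ Γ_ℚ` at a prime `𝔓₀ ∣ q` of `\bar ℤ`
has `h² P ≠ P` for some `P ∈ E[3](ℚ̄)`), and ANY place `w` of `K` above `q`: the `Γ_{K_w}`-invariants of
`E[3](K̄)|_{Γ_{K_w}}` (restricted module `GaloisRep.restrictField (w.adicCompletion K) …`, `Γ_{K_w}` acting through
`absGaloisRestrict K K_w`) number AT MOST `3` — i.e. `E[3] ⊄ E(K_w)`, `h⁰ ≤ 1`; this is the hypothesis (H0) of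
`Method2.Iso.hiso_of_h0` ∕ `hline_of_h0` (koly MEMO-v8 §2(a): at a good prime `Frob_w = u²`, `u ≠ 1` unipotent, and
`E[3]^{Γ_{K_w}} = ker N` is the toric LINE). PROOF (the tree's Gross-1991 machinery, no named fact): move `h` to a
Frobenius `h' = τhτ⁻¹` at the trace `𝔓' = ι⁻¹𝔓` on `\bar ℤ` of the prime `𝔓 = 𝔓_{ι₀,𝔐}` of `\bar ℤ_K` cut out by the
chosen embedding `ι₀ : K̄ → K̄_w` (`primeBelow`, `comap_absIntegersMap_mem_primesAbove`,
`exists_isArithFrobAt_conj_of_mem_primesAbove_holds`); `h'²` fixes `K` (`Gal(K/ℚ)` has order `2`), so `h'² = res F`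
for some `F ∈ Γ_K` (`mem_range_absGaloisRestrict_iff`), which stabilises `𝔓` (`comap_absIntegersMap_smul`,
`IsArithFrobAt.mem_stabilizer`, `comap_absIntegersMap_injective`) and moves the point `Q = θ(τP) ∈ E[3](K̄)`
(`RatClosure.torsionEquiv_smul`); by the local–global principle for decomposition groups
(`exists_apply_eq_smul_of_mem_decompositionSubgroup`, Neukirch II (9.6)) `F = res σ` for some `σ ∈ Γ_{K_w}`, so `Q` is
not invariant and the invariants form a proper subgroup of `E[3](K̄) ≅ (ℤ/3)²`, of order `1` or `3`. Neither good
reduction nor `q ≠ 3` nor inertness is needed for the inequality. [cite: NeukirchANT1999, Ch. I §9 (9.3)–(9.5), Ch. II (9.6)]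
[cite: WZhang2014, Notations (xii)] [cite: BertoliniDarmon2005, §2.2] -/
theorem natCard_invariants_le_three_of_frobSqNeOneAt (hK : IsImaginaryQuadratic K)
    (q : {q // IsUAdmissiblePrime W K q}) (hq : FrobSqNeOneAt W 3 q.1)
    (w : HeightOneSpectrum (𝓞 K)) (hw : ((q : ℕ) : 𝓞 K) ∈ w.asIdeal) :
    Nat.card (GaloisRep.restrictField (w.adicCompletion K)
      ((W.baseChange K).torsionGaloisModule ((3 ^ 1 : ℕ) : ℤ))).toTopRep.ρ.invariants ≤ 3 := by
  haveI : Algebra.IsQuadraticExtension ℚ K := ⟨hK.1⟩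
  have hqp : (q : ℕ).Prime := q.2.1
  -- ### the datum `FrobSqNeOneAt`: `h` Frobenius at `𝔓₀ ∣ q`, `h² P ≠ P`
  obtain ⟨v₀, 𝔓₀, h, hqv₀, h𝔓₀, hFrob, P, hP⟩ := hq
  -- ### the place `v₀` of `ℚ` is the one below `w`
  set v₁ : HeightOneSpectrum (𝓞 ℚ) := w.under (𝓞 ℚ) with hv₁
  have hwv₁ : w.asIdeal.under (𝓞 ℚ) = v₁.asIdeal := rfl
  have hqv₁ : ((q : ℕ) : 𝓞 ℚ) ∈ v₁.asIdeal := by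
    rw [← hwv₁, Ideal.under_def, Ideal.mem_comap, map_natCast]
    exact hw
  have hv : v₀ = v₁ := eq_of_natCast_mem_rat' hqp hqv₀ hqv₁
  subst hv
  -- ### the prime `𝔓` of `\bar ℤ_K` cut out by the chosen embedding `K̄ → K̄_w`, and its trace `𝔓'`
  set ι₀ := closureEmb (K := K) (w.adicCompletion K) with hι₀
  obtain ⟨𝔐, h𝔐⟩ := w.localPrimesAbove_nonempty
  set 𝔓 := w.primeBelow ι₀ 𝔐 with h𝔓def
  have h𝔓 : 𝔓 ∈ w.primesAbove := HeightOneSpectrum.primeBelow_mem_primesAbove h𝔐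
  set 𝔓' := 𝔓.comap (absIntegersMap ℚ K) with h𝔓'def
  have h𝔓' : 𝔓' ∈ (w.under (𝓞 ℚ)).primesAbove := comap_absIntegersMap_mem_primesAbove hwv₁ h𝔓
  haveI : 𝔓'.IsPrime := h𝔓'.1
  -- ### conjugate `h` to a Frobenius `h'` at `𝔓'`
  obtain ⟨τ, -, hFrob'⟩ :=
    HeightOneSpectrum.exists_isArithFrobAt_conj_of_mem_primesAbove_holds h𝔓₀ h𝔓' hFrob
  set h' := τ * h * τ⁻¹ with hh'
  have hP' : h' • h' • (τ • P) ≠ τ • P := by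
    intro hc
    apply hP
    have hg : h' * h' * τ = τ * (h * h) := by rw [hh']; group
    rw [smul_smul, smul_smul, hg, mul_smul, mul_smul] at hc
    exact smul_left_cancel τ hc
  -- ### `h'²` restricts from an element `F ∈ Γ_K`
  have hcard : Nat.card (K ≃ₐ[ℚ] K) = 2 := by rw [IsGalois.card_aut_eq_finrank, hK.1]
  have hsq : ∀ s : K ≃ₐ[ℚ] K, s ^ 2 = 1 := fun s ↦ by rw [← hcard]; exact pow_card_eq_one'
  have hmem : h' ^ 2 ∈ Set.range (absGaloisRestrict ℚ K) := by
    rw [mem_range_absGaloisRestrict_iff]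
    intro x
    rw [map_pow]
    have h1 : ∀ t : AlgebraicClosure K ≃ₐ[ℚ] AlgebraicClosure K,
        (t ^ 2) (algebraMap K (AlgebraicClosure K) x) =
          algebraMap K (AlgebraicClosure K) ((t.restrictNormal K ^ 2) x) := fun t ↦ by
      rw [pow_two, pow_two, AlgEquiv.mul_apply, AlgEquiv.mul_apply, AlgEquiv.restrictNormal_commutes,
        AlgEquiv.restrictNormal_commutes]
    have h2 := h1 (absGaloisTransport (K := ℚ) (L := K) h')
    rw [hsq, AlgEquiv.one_apply] at h2
    exact h2
  obtain ⟨F, hresF⟩ := hmem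
  -- ### `F` moves the point `Q = θ (τ • P)` of `E[3](K̄)`
  set θ := RatClosure.torsionEquiv (K := K) W ((3 ^ 1 : ℕ) : ℤ) with hθ
  have hFQ : F • θ (τ • P) ≠ θ (τ • P) := by
    intro hc
    rw [← RatClosure.torsionEquiv_smul, hresF, pow_two, mul_smul] at hc
    exact hP' (θ.injective hc)
  -- ### `F` lies in the decomposition group of `𝔓`
  have hF𝔓 : F ∈ 𝔓.decompositionSubgroup (absoluteGaloisGroup K) := by
    rw [Ideal.mem_decompositionSubgroup_iff]
    apply comap_absIntegersMap_injective ℚ K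
    rw [comap_absIntegersMap_smul, hresF]
    have hst : h' ∈ MulAction.stabilizer (absoluteGaloisGroup ℚ) 𝔓' := hFrob'.mem_stabilizer
    rw [MulAction.mem_stabilizer_iff] at hst
    change (h' ^ 2) • 𝔓' = 𝔓'
    rw [pow_two, mul_smul, hst, hst]
  -- ### local–global: `F` is the restriction of some `σ ∈ Γ_{K_w}`
  obtain ⟨σ, hσ⟩ := exists_apply_eq_smul_of_mem_decompositionSubgroup ι₀ h𝔐 hF𝔓
  have hresσ : resGal (K := K) (w.adicCompletion K) σ = F := by
    rw [resGal_eq]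
    exact resGalOfEmb_eq_of_apply_eq ι₀ hσ
  -- ### `σ` moves `Q`, so the invariants are a proper subgroup of `E[3](K̄)` (order `9`)
  set H := (GaloisRep.restrictField (w.adicCompletion K)
      ((W.baseChange K).torsionGaloisModule ((3 ^ 1 : ℕ) : ℤ))).toTopRep.ρ.invariants with hHdef
  have hQH : θ (τ • P) ∉ H := by
    intro hmem
    have h1 := (ContRepresentation.mem_invariants _).mp hmem σ
    apply hFQ
    have h2 : absGaloisRestrict K (w.adicCompletion K) σ • θ (τ • P) = θ (τ • P) := h1
    rwa [← resGal_eq_absGaloisRestrict, hresσ] at h2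
  have hHtop : H.toAddSubgroup ≠ ⊤ := by
    intro htop
    apply hQH
    have : θ (τ • P) ∈ H.toAddSubgroup := by rw [htop]; exact AddSubgroup.mem_top _
    exact this
  have h9 : Nat.card (geomTorsion (W.baseChange K) ((3 ^ 1 : ℕ) : ℤ)) = 9 := by
    rw [natCard_geomTorsion (W.baseChange K) ((3 ^ 1 : ℕ) : ℤ) (by norm_num)]
    norm_num
  haveI : Finite (geomTorsion (W.baseChange K) ((3 ^ 1 : ℕ) : ℤ)) :=
    Nat.finite_of_card_ne_zero (by rw [h9]; norm_num)
  have hdvd : Nat.card H.toAddSubgroup ∣ 9 := by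
    rw [← h9]; exact AddSubgroup.card_addSubgroup_dvd_card _
  have hne : Nat.card H.toAddSubgroup ≠ 9 := by
    intro h9'
    apply hHtop
    apply AddSubgroup.eq_top_of_card_eq
    rw [h9', h9]
  change Nat.card H.toAddSubgroup ≤ 3
  have hdvd' : Nat.card H.toAddSubgroup ∣ 3 ^ 2 := by rw [show (3 : ℕ) ^ 2 = 9 by norm_num]; exact hdvd
  obtain ⟨k, hk, hk'⟩ := (Nat.dvd_prime_pow Nat.prime_three).mp hdvd'
  rw [hk'] at hne ⊢
  interval_cases k
  · norm_num
  · norm_num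
  · exact absurd rfl hne

end Summit.BirchSwinnertonDyer.Rank1Residual.X11b.Three.Koly.Method2.Iso

end
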